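import Summits.QuantumFields.GaugeBoot.BootstrapCertificates
import Summits.QuantumFields.GaugeBoot.BootstrapWordBounds
import HarnessLib

/-!
# The certificate cone of the word-truncated bootstrap is Archimedean: `1` is an order unit on words of length `≤ 2n` (gauge-boot, L1/L4 supplement)

HONEST FRAMING (cell `pub-gaugeboot`, page 1 of every file): the venture produces certified bounds
on lattice expectations at stated coupling, gauge group, dimension and torus size; NOT a mass gap,
NOT a continuum limit, NOT a string tension; NOT Yang–Mills-summit-bearing (barriers
`FixedCouplingUltralocality`, `PerturbativeInvisibility`). Algebra only; it certifies no number.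

## Content (unitarity of the link variables as an ALGEBRAIC sum-of-squares identity)

Level `n` of the word-length truncation (`wordTruncation r n` = span of the words of length `≤ n`
in the generators `Re/Im ρ(U_e)_{ab}`; Anderson–Kruczenski, Kazakov–Zheng) has the certificate
cone `certCone r k S β (wordTruncation r n)` = SOS of level-`n` test functions + level-`n` rows
(`BootstrapCertificates.lean`). `BootstrapBounds.lean` proved the FUNCTIONAL form of the
archimedean property (`|φ w| ≤ 1` for feasible `φ`); here is the stronger ALGEBRAIC form, which
is what conic duality needs:

* ★ `one_sub_mul_self_mem_sosCone` — for every word `w` of length `≤ n`, `1 - w w` IS a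
  non-negative combination of squares of level-`n` test functions (induction over the word:
  `1 - (g w')² = (1 - g²) + g² (1 - w'²)` and the unit-row identity
  `Σ_b (Re ρ_{ab})² + (Im ρ_{ab})² = 1`, `sum_sq_entries_eq_one`);
* ★ `one_sub_mul_mem_sosCone` / `one_add_mul_mem_sosCone` — `1 ∓ v w ∈ sosCone` for words
  `v, w` of length `≤ n` (`1 ∓ vw = ½(v ∓ w)² + ½(1 - v²) + ½(1 - w²)`); every word of length
  `≤ 2n` is such a product (`exists_mul_eq_of_mem_wordsUpTo_add`);
* ★★ `exists_smul_one_sub_mem_certCone` — ORDER UNIT: every `x` in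
  `certDomain r k S β n` = span (words of length `≤ 2n`) + level-`n` row space has some `t` with
  `t • 1 - x ∈ certCone r k S β (wordTruncation r n)`; `certCone_le_certDomain` (the cone lives in
  that domain) and `one_mem_certCone_words`.

So `OrderUnitDuality` applies to every level of the word-truncated bootstrap
(`BootstrapCertificateCompleteness.lean`).

References: P. Anderson, M. Kruczenski, Nucl. Phys. B 921 (2017) §2 (unitarity constraints);
C. Josz, D. Henrion, Optim. Lett. 10 (2016) 3 (the ball constraint makes the truncated quadratic
module Archimedean — here unitarity plays that role); M. Laurent, IMA Vol. 149 (2009) §6. Folklore.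
-/

noncomputable section

open scoped Pointwise
open Literature.MathematicalPhysics.QuantumFieldTheory (LatticeRep)

namespace Summit.QuantumFields.GaugeBoot

open OrderUnitDuality

/-! ## Words: products and splittings -/

section Words

variable {ι : Type*} {G : Type*} [Group G] [TopologicalSpace G] (r : LatticeRep G)

/-- The empty word. -/
theorem one_mem_wordsUpTo (n : ℕ) : (1 : C(ι → G, ℝ)) ∈ wordsUpTo (ι := ι) r n :=
  ⟨[], by simp, by simp, by simp⟩

/-- `1` is a test function at every level. -/
theorem one_mem_wordTruncation (n : ℕ) : (1 : C(ι → G, ℝ)) ∈ wordTruncation (ι := ι) r n :=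
  Submodule.subset_span (one_mem_wordsUpTo r n)

/-- Generators are words of length `≤ 1`, hence of every positive length. -/
theorem mem_wordsUpTo_of_mem_entryGens {g : C(ι → G, ℝ)} (hg : g ∈ entryGens (ι := ι) r) {n : ℕ}
    (hn : 1 ≤ n) : g ∈ wordsUpTo (ι := ι) r n :=
  ⟨[g], by simpa using hg, by simpa using hn, by simp⟩

/-- **Concatenation**: the product of words of lengths `≤ m` and `≤ n` is a word of length
`≤ m + n`. -/
theorem mul_mem_wordsUpTo_add {m n : ℕ} {v w : C(ι → G, ℝ)} (hv : v ∈ wordsUpTo (ι := ι) r m)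
    (hw : w ∈ wordsUpTo (ι := ι) r n) : v * w ∈ wordsUpTo (ι := ι) r (m + n) := by
  obtain ⟨l₁, hl₁, hlen₁, rfl⟩ := hv
  obtain ⟨l₂, hl₂, hlen₂, rfl⟩ := hw
  refine ⟨l₁ ++ l₂, fun x hx => ?_, ?_, by rw [List.prod_append]⟩
  · rcases List.mem_append.1 hx with hx | hx
    · exact hl₁ x hx
    · exact hl₂ x hx
  · rw [List.length_append]; exact Nat.add_le_add hlen₁ hlen₂

/-- **Splitting**: a word of length `≤ m + n` is a product of a word of length `≤ m` and a word of
length `≤ n`. -/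
theorem exists_mul_eq_of_mem_wordsUpTo_add {m n : ℕ} {w : C(ι → G, ℝ)}
    (hw : w ∈ wordsUpTo (ι := ι) r (m + n)) :
    ∃ v ∈ wordsUpTo (ι := ι) r m, ∃ v' ∈ wordsUpTo (ι := ι) r n, v * v' = w := by
  obtain ⟨l, hl, hlen, rfl⟩ := hw
  refine ⟨(l.take m).prod, ⟨l.take m, fun x hx => hl x (List.mem_of_mem_take hx),
    (List.length_take_le m l), rfl⟩, (l.drop m).prod, ⟨l.drop m, fun x hx => hl x
    (List.mem_of_mem_drop hx), ?_, rfl⟩, ?_⟩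
  · rw [List.length_drop]; omega
  · rw [← List.prod_append, List.take_append_drop]

/-- **Products of test functions**: level `m` times level `n` lies in level `m + n`. -/
theorem mul_mem_wordTruncation_add {m n : ℕ} {v w : C(ι → G, ℝ)}
    (hv : v ∈ wordTruncation (ι := ι) r m) (hw : w ∈ wordTruncation (ι := ι) r n) :
    v * w ∈ wordTruncation (ι := ι) r (m + n) := by
  rw [wordTruncation, SetLike.mem_coe] at hv hw ⊢
  have h : v * w ∈ Submodule.span ℝ (wordsUpTo (ι := ι) r m) * Submodule.span ℝ (wordsUpTo (ι := ι) r n) :=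
    Submodule.mul_mem_mul hv hw
  rw [Submodule.span_mul_span] at h
  refine Submodule.span_mono (fun x hx => ?_) h
  obtain ⟨a, ha, b, hb, rfl⟩ := Set.mem_mul.1 hx
  exact mul_mem_wordsUpTo_add r ha hb

/-- The difference of two words of length `≤ n` is a level-`n` test function. -/
theorem sub_mem_wordTruncation {n : ℕ} {v w : C(ι → G, ℝ)} (hv : v ∈ wordsUpTo (ι := ι) r n)
    (hw : w ∈ wordsUpTo (ι := ι) r n) : v - w ∈ wordTruncation (ι := ι) r n :=
  (Submodule.span ℝ _).sub_mem (Submodule.subset_span hv) (Submodule.subset_span hw)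

/-- The sum of two words of length `≤ n` is a level-`n` test function. -/
theorem add_mem_wordTruncation {n : ℕ} {v w : C(ι → G, ℝ)} (hv : v ∈ wordsUpTo (ι := ι) r n)
    (hw : w ∈ wordsUpTo (ι := ι) r n) : v + w ∈ wordTruncation (ι := ι) r n :=
  (Submodule.span ℝ _).add_mem (Submodule.subset_span hv) (Submodule.subset_span hw)

/-! ## Unitarity as a sum-of-squares identity -/

/-- Multiplying an element of the level-`n` SOS cone by the square of a generator lands in the
level-`n + 1` SOS cone (`g² v² = (g v)²`). -/
theorem mul_self_mul_mem_sosCone {g : C(ι → G, ℝ)} (hg : g ∈ entryGens (ι := ι) r) {n : ℕ}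
    {x : C(ι → G, ℝ)} (hx : x ∈ sosCone (wordTruncation (ι := ι) r n)) :
    g * g * x ∈ sosCone (wordTruncation (ι := ι) r (n + 1)) := by
  induction hx using Submodule.span_induction with
  | mem y hy =>
    obtain ⟨v, hv, rfl⟩ := hy
    have h : g * g * (v * v) = (g * v) * (g * v) := by ring
    rw [h]
    exact mul_self_mem_sosCone (mul_mem_wordTruncation_succ r hg hv)
  | zero => rw [mul_zero]; exact Submodule.zero_mem _
  | add x y _ _ hx hy => rw [mul_add]; exact Submodule.add_mem _ hx hy
  | smul c x _ hx =>
    have h : g * g * (c • x) = c • (g * g * x) := by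
      rw [show c • x = (c : ℝ) • x from rfl, show c • (g * g * x) = (c : ℝ) • (g * g * x) from rfl,
        mul_smul_comm]
    rw [h]
    exact Submodule.smul_mem _ c hx

/-- **Unit rows as SOS**: for a generator `g = Re/Im ρ(U_e)_{ab}`, `1 - g g` is a sum of squares of
generators (the other entries of the unit row `a`). -/
theorem one_sub_mul_self_mem_sosCone_of_mem_entryGens {g : C(ι → G, ℝ)}
    (hg : g ∈ entryGens (ι := ι) r) {n : ℕ} (hn : 1 ≤ n) :
    1 - g * g ∈ sosCone (wordTruncation (ι := ι) r n) := by
  classical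
  have hgen : ∀ (e : ι) (a b' : Fin r.N),
      reEntry r e a b' * reEntry r e a b' ∈ sosCone (wordTruncation (ι := ι) r n) ∧
        imEntry r e a b' * imEntry r e a b' ∈ sosCone (wordTruncation (ι := ι) r n) := fun e a b' =>
    ⟨mul_self_mem_sosCone (Submodule.subset_span
        (mem_wordsUpTo_of_mem_entryGens r (Or.inl ⟨(e, a, b'), rfl⟩) hn)),
      mul_self_mem_sosCone (Submodule.subset_span
        (mem_wordsUpTo_of_mem_entryGens r (Or.inr ⟨(e, a, b'), rfl⟩) hn))⟩
  rcases hg with ⟨⟨e, a, b⟩, rfl⟩ | ⟨⟨e, a, b⟩, rfl⟩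
  · -- `1 - re² = im² + Σ_{b' ≠ b} (re² + im²)`
    have hsum := sum_sq_entries_eq_one r e a
    rw [← Finset.add_sum_erase _ _ (Finset.mem_univ b)] at hsum
    have h : (1 : C(ι → G, ℝ)) - reEntry r e a b * reEntry r e a b =
        imEntry r e a b * imEntry r e a b +
          ∑ b' ∈ Finset.univ.erase b,
            (reEntry r e a b' * reEntry r e a b' + imEntry r e a b' * imEntry r e a b') := by
      rw [← hsum]; ring
    rw [h]
    refine Submodule.add_mem _ (hgen e a b).2 (Submodule.sum_mem _ fun b' _ => ?_)
    exact Submodule.add_mem _ (hgen e a b').1 (hgen e a b').2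
  · have hsum := sum_sq_entries_eq_one r e a
    rw [← Finset.add_sum_erase _ _ (Finset.mem_univ b)] at hsum
    have h : (1 : C(ι → G, ℝ)) - imEntry r e a b * imEntry r e a b =
        reEntry r e a b * reEntry r e a b +
          ∑ b' ∈ Finset.univ.erase b,
            (reEntry r e a b' * reEntry r e a b' + imEntry r e a b' * imEntry r e a b') := by
      rw [← hsum]; ring
    rw [h]
    refine Submodule.add_mem _ (hgen e a b).1 (Submodule.sum_mem _ fun b' _ => ?_)
    exact Submodule.add_mem _ (hgen e a b').1 (hgen e a b').2

/-- The SOS cones of the word truncation increase with the level. -/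
theorem sosCone_wordTruncation_mono {m n : ℕ} (hmn : m ≤ n) :
    sosCone (wordTruncation (ι := ι) r m) ≤ sosCone (wordTruncation (ι := ι) r n) :=
  sosCone_mono (wordTruncation_mono r hmn)

/-- ★ **`1 - w w` is a sum of squares of level-`n` test functions, for every word `w` of length
`≤ n`** — the algebraic archimedean property of the unitary link variables. [folklore] -/
theorem one_sub_mul_self_mem_sosCone {n : ℕ} {w : C(ι → G, ℝ)} (hw : w ∈ wordsUpTo (ι := ι) r n) :
    1 - w * w ∈ sosCone (wordTruncation (ι := ι) r n) := by
  obtain ⟨l, hl, hlen, rfl⟩ := hw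
  -- induction over the word, at the level of its own length
  suffices h : ∀ l : List C(ι → G, ℝ), (∀ x ∈ l, x ∈ entryGens (ι := ι) r) →
      1 - l.prod * l.prod ∈ sosCone (wordTruncation (ι := ι) r l.length) from
    sosCone_wordTruncation_mono r hlen (h l hl)
  intro l hl
  induction l with
  | nil => simp only [List.prod_nil, mul_one, sub_self, List.length_nil]; exact Submodule.zero_mem _
  | cons g l ih =>
    have hg : g ∈ entryGens (ι := ι) r := hl g (by simp)
    have ih' := ih fun x hx => hl x (by simp [hx])
    rw [List.prod_cons, List.length_cons]
    have h : (1 : C(ι → G, ℝ)) - g * l.prod * (g * l.prod) =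
        (1 - g * g) + g * g * (1 - l.prod * l.prod) := by ring
    rw [h]
    exact Submodule.add_mem _ (one_sub_mul_self_mem_sosCone_of_mem_entryGens r hg (Nat.succ_pos _))
      (mul_self_mul_mem_sosCone r hg ih')

/-- ★ **`1 - v w` is SOS** for words `v`, `w` of length `≤ n`:
`1 - vw = ½ (v - w)² + ½ (1 - v²) + ½ (1 - w²)`. [folklore] -/
theorem one_sub_mul_mem_sosCone {n : ℕ} {v w : C(ι → G, ℝ)} (hv : v ∈ wordsUpTo (ι := ι) r n)
    (hw : w ∈ wordsUpTo (ι := ι) r n) : 1 - v * w ∈ sosCone (wordTruncation (ι := ι) r n) := by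
  have h : (1 : C(ι → G, ℝ)) - v * w = (1 / 2 : ℝ) • ((v - w) * (v - w)) +
      (1 / 2 : ℝ) • (1 - v * v) + (1 / 2 : ℝ) • (1 - w * w) := by
    ext U
    simp only [ContinuousMap.sub_apply, ContinuousMap.add_apply, ContinuousMap.smul_apply,
      ContinuousMap.mul_apply, ContinuousMap.one_apply, smul_eq_mul]
    ring
  rw [h]
  refine Submodule.add_mem _ (Submodule.add_mem _ ?_ ?_) ?_
  · exact smul_mem_of_nonneg (by norm_num) (mul_self_mem_sosCone (sub_mem_wordTruncation r hv hw))
  · exact smul_mem_of_nonneg (by norm_num) (one_sub_mul_self_mem_sosCone r hv)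
  · exact smul_mem_of_nonneg (by norm_num) (one_sub_mul_self_mem_sosCone r hw)

/-- ★ **`1 + v w` is SOS** for words `v`, `w` of length `≤ n`:
`1 + vw = ½ (v + w)² + ½ (1 - v²) + ½ (1 - w²)`. [folklore] -/
theorem one_add_mul_mem_sosCone {n : ℕ} {v w : C(ι → G, ℝ)} (hv : v ∈ wordsUpTo (ι := ι) r n)
    (hw : w ∈ wordsUpTo (ι := ι) r n) : 1 + v * w ∈ sosCone (wordTruncation (ι := ι) r n) := by
  have h : (1 : C(ι → G, ℝ)) + v * w = (1 / 2 : ℝ) • ((v + w) * (v + w)) +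
      (1 / 2 : ℝ) • (1 - v * v) + (1 / 2 : ℝ) • (1 - w * w) := by
    ext U
    simp only [ContinuousMap.sub_apply, ContinuousMap.add_apply, ContinuousMap.smul_apply,
      ContinuousMap.mul_apply, ContinuousMap.one_apply, smul_eq_mul]
    ring
  rw [h]
  refine Submodule.add_mem _ (Submodule.add_mem _ ?_ ?_) ?_
  · exact smul_mem_of_nonneg (by norm_num) (mul_self_mem_sosCone (add_mem_wordTruncation r hv hw))
  · exact smul_mem_of_nonneg (by norm_num) (one_sub_mul_self_mem_sosCone r hv)
  · exact smul_mem_of_nonneg (by norm_num) (one_sub_mul_self_mem_sosCone r hw)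

/-- ★ **Every word of length `≤ 2n` is within `1` of `0` in the SOS order**: `1 - w ∈ sosCone` and
`1 + w ∈ sosCone` at level `n`. [folklore] -/
theorem one_sub_mem_sosCone_and {n : ℕ} {w : C(ι → G, ℝ)} (hw : w ∈ wordsUpTo (ι := ι) r (n + n)) :
    1 - w ∈ sosCone (wordTruncation (ι := ι) r n) ∧ 1 + w ∈ sosCone (wordTruncation (ι := ι) r n) := by
  obtain ⟨v, hv, v', hv', rfl⟩ := exists_mul_eq_of_mem_wordsUpTo_add r hw
  exact ⟨one_sub_mul_mem_sosCone r hv hv', one_add_mul_mem_sosCone r hv hv'⟩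

end Words

/-! ## The order unit -/

section OrderUnit

variable {ι : Type*} [DecidableEq ι] {G : Type*} [Group G] [TopologicalSpace G] (r : LatticeRep G)
  {K : Type*} (k : K → ℝ → G) (S : ι → (ι → G) → ℝ) (β : ℝ)

/-- **The domain of the level-`n` certificates**: linear combinations of words of length `≤ 2n`
plus the level-`n` row space (every objective an SDP at level `n` can bound). [folklore] -/
def certDomain (n : ℕ) : Submodule ℝ C(ι → G, ℝ) :=
  Submodule.span ℝ (wordsUpTo (ι := ι) r (n + n)) ⊔
    rowSpace r k S β (wordTruncation (ι := ι) r n)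

variable {k S β}

/-- Words of length `≤ 2n` are in the certificate domain. -/
theorem mem_certDomain_of_mem_wordsUpTo {n : ℕ} {w : C(ι → G, ℝ)}
    (hw : w ∈ wordsUpTo (ι := ι) r (n + n)) : w ∈ certDomain r k S β n :=
  Submodule.mem_sup_left (Submodule.subset_span hw)

/-- Level-`2n` test functions are in the certificate domain. -/
theorem mem_certDomain_of_mem_wordTruncation {n : ℕ} {x : C(ι → G, ℝ)}
    (hx : x ∈ wordTruncation (ι := ι) r (n + n)) : x ∈ certDomain r k S β n :=
  Submodule.mem_sup_left hx

/-- Row combinations are in the certificate domain. -/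
theorem mem_certDomain_of_mem_rowSpace {n : ℕ} {x : C(ι → G, ℝ)}
    (hx : x ∈ rowSpace r k S β (wordTruncation (ι := ι) r n)) : x ∈ certDomain r k S β n :=
  Submodule.mem_sup_right hx

/-- **The certificate cone lives in the certificate domain** (squares of level-`n` test functions
are level-`2n` test functions). -/
theorem certCone_le_certDomain (n : ℕ) :
    ∀ x ∈ certCone r k S β (wordTruncation (ι := ι) r n), x ∈ certDomain r k S β n := by
  intro x hx
  obtain ⟨σ, hσ, ρ, hρ, rfl⟩ := (mem_certCone_iff r).1 hx
  clear hx
  refine (certDomain r k S β n).add_mem ?_ (mem_certDomain_of_mem_rowSpace r hρ)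
  induction hσ using Submodule.span_induction with
  | mem y hy =>
    obtain ⟨v, hv, rfl⟩ := hy
    exact mem_certDomain_of_mem_wordTruncation r (mul_mem_wordTruncation_add r hv hv)
  | zero => exact Submodule.zero_mem _
  | add x y _ _ hx hy => exact Submodule.add_mem _ hx hy
  | smul c x _ hx =>
    rw [show c • x = (c : ℝ) • x from rfl]
    exact Submodule.smul_mem _ _ hx

/-- `1` is in the level-`n` certificate cone. -/
theorem one_mem_certCone_words (n : ℕ) :
    (1 : C(ι → G, ℝ)) ∈ certCone r k S β (wordTruncation (ι := ι) r n) :=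
  one_mem_certCone r (one_mem_wordTruncation r n)

omit [DecidableEq ι] [Group G] in
/-- The two-sided archimedean set `{x | ∃ t, t • 1 - x ∈ K} ∩ {x | ∃ t, t • 1 + x ∈ K}` of a
pointed cone `K` is a linear subspace: it contains the span of any set it contains. -/
theorem exists_smul_one_sub_mem_of_mem_span {Kc : PointedCone ℝ C(ι → G, ℝ)}
    {s : Set C(ι → G, ℝ)}
    (hs : ∀ x ∈ s, (∃ t : ℝ, t • (1 : C(ι → G, ℝ)) - x ∈ Kc) ∧ ∃ t : ℝ, t • (1 : C(ι → G, ℝ)) + x ∈ Kc)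
    {x : C(ι → G, ℝ)} (hx : x ∈ Submodule.span ℝ s) :
    (∃ t : ℝ, t • (1 : C(ι → G, ℝ)) - x ∈ Kc) ∧ ∃ t : ℝ, t • (1 : C(ι → G, ℝ)) + x ∈ Kc := by
  induction hx using Submodule.span_induction with
  | mem y hy => exact hs y hy
  | zero => exact ⟨⟨0, by rw [zero_smul, sub_zero]; exact Kc.zero_mem⟩,
      ⟨0, by rw [zero_smul, zero_add]; exact Kc.zero_mem⟩⟩
  | add x y _ _ hx hy =>
    obtain ⟨⟨t₁, ht₁⟩, ⟨s₁, hs₁⟩⟩ := hx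
    obtain ⟨⟨t₂, ht₂⟩, ⟨s₂, hs₂⟩⟩ := hy
    refine ⟨⟨t₁ + t₂, ?_⟩, ⟨s₁ + s₂, ?_⟩⟩
    · have h : (t₁ + t₂) • (1 : C(ι → G, ℝ)) - (x + y) = (t₁ • 1 - x) + (t₂ • 1 - y) := by
        rw [add_smul]; abel
      rw [h]; exact Kc.add_mem ht₁ ht₂
    · have h : (s₁ + s₂) • (1 : C(ι → G, ℝ)) + (x + y) = (s₁ • 1 + x) + (s₂ • 1 + y) := by
        rw [add_smul]; abel
      rw [h]; exact Kc.add_mem hs₁ hs₂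
  | smul c x _ hx =>
    obtain ⟨⟨t, ht⟩, ⟨s', hs'⟩⟩ := hx
    rcases le_or_gt 0 c with hc | hc
    · refine ⟨⟨c * t, ?_⟩, ⟨c * s', ?_⟩⟩
      · rw [mul_smul, ← smul_sub]; exact smul_mem_of_nonneg hc ht
      · rw [mul_smul, ← smul_add]; exact smul_mem_of_nonneg hc hs'
    · refine ⟨⟨(-c) * s', ?_⟩, ⟨(-c) * t, ?_⟩⟩
      · have h : ((-c) * s') • (1 : C(ι → G, ℝ)) - c • x = (-c) • (s' • 1 + x) := by
          simp only [mul_smul, smul_add, neg_smul]; abel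
        rw [h]; exact smul_mem_of_nonneg (neg_nonneg.2 hc.le) hs'
      · have h : ((-c) * t) • (1 : C(ι → G, ℝ)) + c • x = (-c) • (t • 1 - x) := by
          simp only [mul_smul, smul_sub, neg_smul]; abel
        rw [h]; exact smul_mem_of_nonneg (neg_nonneg.2 hc.le) ht

/-- ★★ **`1` is an order unit for the level-`n` certificate cone on the certificate domain**: every
linear combination of words of length `≤ 2n` and level-`n` rows is dominated, in the order of
`certCone`, by a multiple of `1` (and so is its negative). [folklore] -/
theorem exists_smul_one_sub_mem_certCone {n : ℕ} {x : C(ι → G, ℝ)} (hx : x ∈ certDomain r k S β n) :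
    (∃ t : ℝ, t • (1 : C(ι → G, ℝ)) - x ∈ certCone r k S β (wordTruncation (ι := ι) r n)) ∧
      ∃ t : ℝ, t • (1 : C(ι → G, ℝ)) + x ∈ certCone r k S β (wordTruncation (ι := ι) r n) := by
  -- the certificate domain is the span of words of length `≤ 2n` and row elements
  have hx' : x ∈ Submodule.span ℝ (wordsUpTo (ι := ι) r (n + n) ∪
      rowSet r k S β (wordTruncation (ι := ι) r n)) := by
    rw [Submodule.span_union]; exact hx
  refine exists_smul_one_sub_mem_of_mem_span (fun y hy => ?_) hx'
  rcases hy with hy | hy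
  · obtain ⟨hm, hp⟩ := one_sub_mem_sosCone_and r hy
    exact ⟨⟨1, by rw [one_smul]; exact sosCone_le_certCone r hm⟩,
      ⟨1, by rw [one_smul]; exact sosCone_le_certCone r hp⟩⟩
  · refine ⟨⟨0, ?_⟩, ⟨0, ?_⟩⟩
    · rw [zero_smul, zero_sub]
      exact mem_certCone_of_mem_rowSpace r ((rowSpace r k S β _).neg_mem (Submodule.subset_span hy))
    · rw [zero_smul, zero_add]
      exact mem_certCone_of_mem_rowSet r hy

/-- ★★ **The hypotheses of `OrderUnitDuality` hold at every level of the word-truncated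
bootstrap**: the certificate cone is contained in the certificate domain, contains `1`, and `1`
is an order unit there. [folklore] -/
theorem certCone_orderUnit (n : ℕ) :
    (∀ x ∈ certCone r k S β (wordTruncation (ι := ι) r n), x ∈ certDomain r k S β n) ∧
      (1 : C(ι → G, ℝ)) ∈ certCone r k S β (wordTruncation (ι := ι) r n) ∧
        ∀ x ∈ certDomain r k S β n, ∃ t : ℝ,
          t • (1 : C(ι → G, ℝ)) - x ∈ certCone r k S β (wordTruncation (ι := ι) r n) :=
  ⟨certCone_le_certDomain r n, one_mem_certCone_words r n,
    fun _ hx => (exists_smul_one_sub_mem_certCone r hx).1⟩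

end OrderUnit

end Summit.QuantumFields.GaugeBoot

end
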